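import Summits.ABC.ABC.Theses.IsogenyGlueCongruence

/-!
# `SharpDegreeOfPolyDegree` (stmt-ABC-10895): logical position of the crux

Negative support lemmas for the crux `R := Summit.ABC.ABC.Theses.IsogenyGlueCongruence.SharpDegreeOfPolyDegree`
(`PolyDegreeBound → SemistableDegreeConjecture`), from the cdisprove seat (2026-08-16); companion of
`Negative/ExponentFloor.lean`. No definitions.

* `not_sharpDegreeOfPolyDegree_iff` — what a disproof of `R` must contain: a PROOF of the polynomial
  modular-degree conjecture for all semistable curves AND a refutation of the target `X`; in
  particular `R` cannot be refuted without constructing modular parametrisation data for every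
  semistable curve (modularity), so it is unkillable from inside the present tree, and every junk
  scenario (an empty datum type, an empty binder class) makes `R` true.
* `not_shape_amplification` — `R` is not a shape-level triviality: "polynomially bounded ⟹ bounded by
  `C(ε) n^{2+ε}`" is false for `d n = n⁴`; any proof of `R` must use the arithmetic of modular degrees.
* `degreeBound_two_of_const_uniform_in_eps` — an `ε`-UNIFORM constant in `X` collapses it to
  `deg ≤ C N²` (minimal-degree datum + `ε → 0⁺`), the borderline exponent left open by the floor of
  `Negative/ExponentFloor.lean`.
-/

noncomputable section

namespace Summit.ABC.ABC.Theorems.SharpDegreeOfPolyDegree.Negative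

open Summit.ABC.ABC.Theses.IsogenyGlueCongruence
open Literature.NumberTheory.EllipticCurves Literature.NumberTheory.EllipticCurves.ModularForms
open WeierstrassCurve CongruenceSubgroup Filter Topology

/-! ## Logical position -/

/-- **What a disproof of `R` must contain**: `¬ R ↔ (PolyDegreeBound ∧ ¬ X)` — a proof of the
polynomial modular-degree conjecture for all semistable curves together with a refutation of the
target. [folklore] -/
theorem not_sharpDegreeOfPolyDegree_iff :
    ¬ SharpDegreeOfPolyDegree ↔
      ((∃ κ C : ℝ, ∀ (W : WeierstrassCurve ℚ) [W.IsElliptic] [W.IsGloballyMinimal]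
          [NeZero (W.conductorNorm ℤ)], W.IsSemistable ℤ →
            ∃ D : ModularParametrizationData W (W.conductorNorm ℤ),
              (D.modularDegree : ℝ) ≤ C * (W.conductorNorm ℤ : ℝ) ^ κ) ∧
        ¬ SemistableDegreeConjecture) := by
  unfold SharpDegreeOfPolyDegree
  exact Classical.not_imp

/-- **`R` is not a shape-level triviality.** The abstract amplification "any polynomially bounded
`d : ℕ → ℕ` is bounded by `C(ε) n^{2+ε}` for every `ε > 0`" is false (`d n = n⁴`, `ε = 1`): no proof
of `R` can avoid the arithmetic of modular degrees. [folklore] -/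
theorem not_shape_amplification :
    ¬ ∀ d : ℕ → ℕ, (∃ κ C : ℝ, ∀ n : ℕ, 0 < n → (d n : ℝ) ≤ C * (n : ℝ) ^ κ) →
        ∀ ε : ℝ, 0 < ε → ∃ C : ℝ, ∀ n : ℕ, 0 < n → (d n : ℝ) ≤ C * (n : ℝ) ^ (2 + ε) := by
  intro h
  have hpoly : ∃ κ C : ℝ, ∀ n : ℕ, 0 < n →
      (((fun m : ℕ => m ^ 4) n : ℕ) : ℝ) ≤ C * (n : ℝ) ^ κ := by
    refine ⟨4, 1, fun n _ => ?_⟩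
    rw [one_mul, show (4 : ℝ) = ((4 : ℕ) : ℝ) by norm_num, Real.rpow_natCast]
    push_cast
    exact le_rfl
  obtain ⟨C, hC⟩ := h (fun m => m ^ 4) hpoly 1 one_pos
  set n : ℕ := ⌈C⌉₊ + 1 with hn
  have hn0 : 0 < n := Nat.succ_pos _
  have hCn : C < n := by
    have := Nat.le_ceil C
    rw [hn]
    push_cast
    linarith
  have key := hC n hn0
  rw [show (2 : ℝ) + 1 = ((3 : ℕ) : ℝ) by norm_num, Real.rpow_natCast] at key
  push_cast at key
  have h3 : (0 : ℝ) < (n : ℝ) ^ 3 := by positivity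
  have hmul : (n : ℝ) * (n : ℝ) ^ 3 ≤ C * (n : ℝ) ^ 3 := by
    calc (n : ℝ) * (n : ℝ) ^ 3 = (n : ℝ) ^ 4 := by ring
      _ ≤ C * (n : ℝ) ^ 3 := key
  have := le_of_mul_le_mul_right hmul h3
  linarith

/-! ## An `ε`-uniform constant -/

/-- **An `ε`-uniform constant collapses the target to exponent exactly `2`.** If ONE constant `C`
served every `ε > 0` in `X`, then (degrees being positive integers, a minimal-degree datum exists and
`C N^{2+ε} → C N²` as `ε → 0⁺`) every semistable curve would have a datum with `deg ≤ C N²`.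
(The borderline `deg ≤ C N²` is not refuted here: that needs `(f,f) ≫ N/(log N)^A`.) [folklore] -/
theorem degreeBound_two_of_const_uniform_in_eps
    (h : ∃ C : ℝ, ∀ ε : ℝ, 0 < ε → ∀ (W : WeierstrassCurve ℚ) [W.IsElliptic] [W.IsGloballyMinimal]
      [NeZero (W.conductorNorm ℤ)], W.IsSemistable ℤ →
        ∃ D : ModularParametrizationData W (W.conductorNorm ℤ),
          (D.modularDegree : ℝ) ≤ C * (W.conductorNorm ℤ : ℝ) ^ (2 + ε)) :
    ∃ C : ℝ, ∀ (W : WeierstrassCurve ℚ) [W.IsElliptic] [W.IsGloballyMinimal]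
      [NeZero (W.conductorNorm ℤ)], W.IsSemistable ℤ →
        ∃ D : ModularParametrizationData W (W.conductorNorm ℤ),
          (D.modularDegree : ℝ) ≤ C * (W.conductorNorm ℤ : ℝ) ^ (2 : ℝ) := by
  obtain ⟨C, hC⟩ := h
  refine ⟨C, fun W _ _ _ hss => ?_⟩
  -- a datum of minimal degree
  have hne : ∃ m : ℕ, ∃ D : ModularParametrizationData W (W.conductorNorm ℤ),
      D.modularDegree = m := by
    obtain ⟨D, -⟩ := hC 1 one_pos W hss
    exact ⟨_, D, rfl⟩
  classical
  obtain ⟨D₀, hD₀⟩ := Nat.find_spec hne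
  refine ⟨D₀, ?_⟩
  have hmin : ∀ D : ModularParametrizationData W (W.conductorNorm ℤ),
      D₀.modularDegree ≤ D.modularDegree := fun D => by
    rw [hD₀]
    exact Nat.find_min' hne ⟨D, rfl⟩
  have hN0 : (0 : ℝ) < (W.conductorNorm ℤ : ℝ) := by
    exact_mod_cast NeZero.pos (W.conductorNorm ℤ)
  -- `deg D₀ ≤ C N^{2+ε}` for every `ε > 0`
  have hdeg : ∀ ε : ℝ, 0 < ε →
      (D₀.modularDegree : ℝ) ≤ C * (W.conductorNorm ℤ : ℝ) ^ (2 + ε) := by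
    intro ε hε
    obtain ⟨D, hD⟩ := hC ε hε W hss
    exact le_trans (by exact_mod_cast hmin D) hD
  -- let `ε → 0⁺`
  have ht : Tendsto (fun ε : ℝ => C * (W.conductorNorm ℤ : ℝ) ^ (2 + ε)) (𝓝[>] 0)
      (𝓝 (C * (W.conductorNorm ℤ : ℝ) ^ (2 + (0 : ℝ)))) := by
    apply Tendsto.const_mul
    have h1 : Tendsto (fun ε : ℝ => 2 + ε) (𝓝[>] (0 : ℝ)) (𝓝 (2 + 0)) :=
      ((continuous_const_add (2 : ℝ)).tendsto 0).mono_left nhdsWithin_le_nhds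
    exact (Real.continuousAt_const_rpow hN0.ne').tendsto.comp h1
  rw [add_zero] at ht
  refine ge_of_tendsto ht ?_
  filter_upwards [self_mem_nhdsWithin] with ε hε
  exact hdeg ε hε

end Summit.ABC.ABC.Theorems.SharpDegreeOfPolyDegree.Negative
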